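import Mathlib.Algebra.GroupWithZero.Subgroup
import Mathlib.Algebra.Group.Pointwise.Set.Card
import Mathlib.GroupTheory.IndexNormal
import Mathlib.GroupTheory.Coset.Card
import Mathlib.Data.ZMod.QuotientGroup
import Mathlib.Data.Nat.Prime.Int
import Mathlib.Tactic.Group
import Mathlib.Tactic.IntervalCases
import Mathlib.Tactic.Module
import HarnessLib

/-!
# Stable lines of a `p`-torsion plane: index-two descent of uniqueness (odd `p`)
# (helper file for crux `GoodLatticeBDPValue`, stmt-BirchSwinnertonDyer-19032, line `halves`)

Cell `bsd-eis`, width seat `bsd-line-x1-p1-w5` gen 24 (offer of `-w6` gen 23).  THEOREMS ONLY (no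
definition / named fact / instance / `sorry` / `Theses` import; imports `Mathlib` only).
`--supports stmt-BirchSwinnertonDyer-19032`.  WHAT.  Folklore linear algebra of a group `G` acting additively (`DistribMulAction G A`) on an
abelian group `A`, restricted to a `G`-stable subgroup `T ≤ A` with `Nat.card T = p ^ 2` and
`p • T = 0` (`T ≃ (ℤ/p)²`), whose *lines* are the subgroups of order `p` inside `T`.  Everything
is phrased in the vocabulary `AddSubgroup` / `Nat.card` / `∀ σ, ∀ P ∈ Φ, σ • P ∈ Φ` of the
hypothesis `huniq` of `Literature.NumberTheory.EllipticCurves.KellerYin2024.IsResidualPairOver.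
eq_of_unique_line` (no `Module (ZMod p)` structure is put on `T`), so that the results apply
verbatim to `T = E[p](K̄)` with its Galois action.

* `eq_or_eq_or_eq_of_forall_smul_mem` — an element `g` that is NOT an integer scalar on `T`
  stabilises at most two lines (three `g`-stable lines are not pairwise distinct);
* `smul_mem_of_normal` — case (a): `H ⊴ G` with some `h ∈ H` non-scalar on `T`, `L` a `G`-stable
  line, `Φ ≠ L` an `H`-stable line ⇒ `Φ` is `G`-stable (`L, Φ, g • Φ` cannot be distinct);
* `false_of_forall_exists_smul_eq` — case (b): every `h ∈ H` scalar on `T`, `[G : H] = 2`, `p`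
  ODD ⇒ `T` cannot have exactly one `G`-stable line (`g ∉ H`, `g • P₀ = a • P₀`, `g² ∈ H` scalar,
  `R := g • Q - a • Q` has `g • R = -a • R`; `R = 0` makes `⟨Q⟩` a second `G`-line, else
  `⟨R⟩ = L`, `2a • R = 0`, `p ∣ a`, `g • P₀ = 0`);
* **`eq_of_index_two`**, **`unique_of_index_two`**, **`unique_of_range_index_two`** — the descent:
  `H ≤ G` of index two (or the range of a homomorphism `Γ →* G` of index two, e.g. restriction
  `Γ_K → Γ_ℚ` for `K` quadratic), `p` odd: exactly one `G`-stable line ⇒ exactly one `H`-stable.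

False for `p = 2` (`C₂` swapping the coordinates of `(ℤ/2)²`) and for index `p` (unipotent `C_p`),
whence `p ≠ 2` and `H.index = 2`.  USE: the `Γ_ℚ → Γ_K` step in the uniqueness of the residual pair
`(θsub, θquot)` of `E[p]` at an Eisenstein prime (Keller–Yin 2024 §1.4), with NO hypothesis on
inertia, on the splitting of `p` in `K`, or on the characters.  HONEST: pure group theory; closes
no stub; no summit statement, no case of BSD, no crux is proved here; 0 cells / labels / tiers move.

References: [KellerYin2024] §1.4; [CastellaGrossiLeeSkinner2022] Thm. 2.2.2 (the residual pair). -/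

-- `Summit.BirchSwinnertonDyer.BirchSwinnertonDyer.…` repeats a namespace component by design (D-0017).
set_option linter.dupNamespace false

open scoped Pointwise

namespace Summit.BirchSwinnertonDyer.BirchSwinnertonDyer.Theorems.StableLine

variable {G A : Type*} [Group G] [AddCommGroup A] [DistribMulAction G A]
variable {p : ℕ} [hp : Fact p.Prime]

/-! ### Lines of a `p`-torsion plane -/

/-- In a subgroup `T` killed by the prime `p`, a nonzero element has additive order `p`. [folklore] -/
theorem addOrderOf_eq_of_mem {T : AddSubgroup A} (hpT : ∀ P ∈ T, (p : ℤ) • P = 0)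
    {P : A} (hP : P ∈ T) (hP0 : P ≠ 0) : addOrderOf P = p :=
  addOrderOf_eq_prime (by rw [← natCast_zsmul]; exact hpT P hP) hP0

/-- For a nonzero `P` in a subgroup killed by the prime `p`: `k • P = 0 ↔ p ∣ k`. [folklore] -/
theorem zsmul_eq_zero_iff_dvd {T : AddSubgroup A} (hpT : ∀ P ∈ T, (p : ℤ) • P = 0)
    {P : A} (hP : P ∈ T) (hP0 : P ≠ 0) (k : ℤ) : k • P = 0 ↔ (p : ℤ) ∣ k := by
  rw [← addOrderOf_dvd_iff_zsmul_eq_zero, addOrderOf_eq_of_mem hpT hP hP0]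

omit hp in
/-- In a subgroup killed by `p`, multiples of `p` act as zero. [folklore] -/
theorem zsmul_eq_zero_of_dvd {T : AddSubgroup A} (hpT : ∀ P ∈ T, (p : ℤ) • P = 0)
    {P : A} (hP : P ∈ T) {k : ℤ} (hk : (p : ℤ) ∣ k) : k • P = 0 := by
  obtain ⟨c, rfl⟩ := hk
  rw [mul_comm, mul_smul, hpT P hP, smul_zero]

/-- A nonzero element of a subgroup killed by the prime `p` generates a subgroup of order `p`.
[folklore] -/
theorem card_zmultiples_eq {T : AddSubgroup A} (hpT : ∀ P ∈ T, (p : ℤ) • P = 0)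
    {P : A} (hP : P ∈ T) (hP0 : P ≠ 0) : Nat.card (AddSubgroup.zmultiples P) = p := by
  rw [Nat.card_zmultiples, addOrderOf_eq_of_mem hpT hP hP0]

/-- A line (subgroup of order `p` inside the `p`-torsion subgroup `T`) is generated by any of its
nonzero elements. [folklore] -/
theorem eq_zmultiples_of_mem {T Φ : AddSubgroup A} (hpT : ∀ P ∈ T, (p : ℤ) • P = 0)
    (hΦ : Nat.card Φ = p) (hΦT : Φ ≤ T) {P : A} (hP : P ∈ Φ) (hP0 : P ≠ 0) :
    Φ = AddSubgroup.zmultiples P := by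
  haveI : Finite Φ := Nat.finite_of_card_ne_zero (by rw [hΦ]; exact hp.out.ne_zero)
  exact (AddSubgroup.eq_of_le_of_card_ge (AddSubgroup.zmultiples_le.mpr hP)
    (le_of_eq (by rw [hΦ, card_zmultiples_eq hpT (hΦT hP) hP0]))).symm

/-- Every element of a line is an integer multiple of any nonzero element of it. [folklore] -/
theorem exists_zsmul_eq_of_mem {T Φ : AddSubgroup A} (hpT : ∀ P ∈ T, (p : ℤ) • P = 0)
    (hΦ : Nat.card Φ = p) (hΦT : Φ ≤ T) {P : A} (hP : P ∈ Φ) (hP0 : P ≠ 0) {Q : A} (hQ : Q ∈ Φ) :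
    ∃ k : ℤ, k • P = Q := by
  rw [eq_zmultiples_of_mem hpT hΦ hΦT hP hP0] at hQ
  exact AddSubgroup.mem_zmultiples_iff.mp hQ

/-- A subgroup of prime order contains a nonzero element. [folklore] -/
theorem exists_ne_zero_of_card {Φ : AddSubgroup A} (hΦ : Nat.card Φ = p) : ∃ P ∈ Φ, P ≠ 0 := by
  refine (AddSubgroup.bot_or_exists_ne_zero Φ).resolve_left fun h ↦ ?_
  rw [h, AddSubgroup.card_bot] at hΦ
  exact hp.out.one_lt.ne hΦ

/-- Two lines sharing a nonzero element are equal. [folklore] -/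
theorem eq_of_mem_of_mem {T Φ₁ Φ₂ : AddSubgroup A} (hpT : ∀ P ∈ T, (p : ℤ) • P = 0)
    (h₁ : Nat.card Φ₁ = p) (h₁T : Φ₁ ≤ T) (h₂ : Nat.card Φ₂ = p) (h₂T : Φ₂ ≤ T)
    {P : A} (hP₁ : P ∈ Φ₁) (hP₂ : P ∈ Φ₂) (hP0 : P ≠ 0) : Φ₁ = Φ₂ := by
  rw [eq_zmultiples_of_mem hpT h₁ h₁T hP₁ hP0, eq_zmultiples_of_mem hpT h₂ h₂T hP₂ hP0]

/-- A plane of order `p ^ 2` is not contained in a line of order `p`. [folklore] -/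
theorem exists_mem_not_mem {T Φ : AddSubgroup A} (hT : Nat.card T = p ^ 2) (hΦ : Nat.card Φ = p) :
    ∃ Q ∈ T, Q ∉ Φ := by
  by_contra! h
  haveI : Finite Φ := Nat.finite_of_card_ne_zero (by rw [hΦ]; exact hp.out.ne_zero)
  have hle := AddSubgroup.card_le_of_le (show T ≤ Φ from h)
  rw [hT, hΦ] at hle
  exact absurd hle (not_le.mpr (lt_self_pow₀ hp.out.one_lt one_lt_two))

/-- Two distinct lines span the plane. [folklore] -/
theorem sup_eq_of_ne {T Φ₁ Φ₂ : AddSubgroup A} (hT : Nat.card T = p ^ 2)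
    (h₁ : Nat.card Φ₁ = p) (h₁T : Φ₁ ≤ T) (h₂ : Nat.card Φ₂ = p) (h₂T : Φ₂ ≤ T) (hne : Φ₁ ≠ Φ₂) :
    Φ₁ ⊔ Φ₂ = T := by
  haveI : Finite T := Nat.finite_of_card_ne_zero (by rw [hT]; exact pow_ne_zero _ hp.out.ne_zero)
  haveI : Finite Φ₁ := Nat.finite_of_card_ne_zero (by rw [h₁]; exact hp.out.ne_zero)
  have hle : Φ₁ ⊔ Φ₂ ≤ T := sup_le h₁T h₂T
  haveI : Finite ↥(Φ₁ ⊔ Φ₂) := Finite.of_injective _ (AddSubgroup.inclusion_injective hle)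
  obtain ⟨m, hm, hcard⟩ := (Nat.dvd_prime_pow hp.out).mp (hT ▸ AddSubgroup.card_dvd_of_le hle)
  have hp1 : p ∣ p ^ m := by
    have := AddSubgroup.card_dvd_of_le (le_sup_left : Φ₁ ≤ Φ₁ ⊔ Φ₂)
    rwa [h₁, hcard] at this
  interval_cases m
  · rw [pow_zero, Nat.dvd_one] at hp1
    exact absurd hp1 hp.out.one_lt.ne'
  · exfalso
    have e1 : Φ₁ = Φ₁ ⊔ Φ₂ :=
      AddSubgroup.eq_of_le_of_card_ge le_sup_left (by rw [hcard, pow_one, h₁])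
    exact hne (AddSubgroup.eq_of_le_of_card_ge (le_sup_right.trans e1.ge) (by rw [h₁, h₂])).symm
  · exact AddSubgroup.eq_of_le_of_card_ge hle (by rw [hT, hcard])

/-! ### A non-scalar element stabilises at most two lines -/

/-- **A non-scalar endomorphism of `(ℤ/p)²` stabilises at most two lines.**  If `g` is not an
integer scalar on the plane `T` (`¬ ∃ s : ℤ, ∀ P ∈ T, g • P = s • P`), then three `g`-stable lines
of `T` are not pairwise distinct.  (Eigenvalues `λᵢ` on `Φᵢ = ⟨Pᵢ⟩`; writing `P₃ = m P₁ + n P₂` with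
`p ∤ m, n` gives `λ₁ ≡ λ₃ ≡ λ₂ (mod p)`, so `g = λ₁` on `T = Φ₁ + Φ₂`.) [folklore] -/
theorem eq_or_eq_or_eq_of_forall_smul_mem {T Φ₁ Φ₂ Φ₃ : AddSubgroup A} (hT : Nat.card T = p ^ 2)
    (hpT : ∀ P ∈ T, (p : ℤ) • P = 0) (g : G) (hns : ¬ ∃ s : ℤ, ∀ P ∈ T, g • P = s • P)
    (h₁ : Nat.card Φ₁ = p) (h₁T : Φ₁ ≤ T) (h₁g : ∀ P ∈ Φ₁, g • P ∈ Φ₁)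
    (h₂ : Nat.card Φ₂ = p) (h₂T : Φ₂ ≤ T) (h₂g : ∀ P ∈ Φ₂, g • P ∈ Φ₂)
    (h₃ : Nat.card Φ₃ = p) (h₃T : Φ₃ ≤ T) (h₃g : ∀ P ∈ Φ₃, g • P ∈ Φ₃) :
    Φ₁ = Φ₂ ∨ Φ₁ = Φ₃ ∨ Φ₂ = Φ₃ := by
  by_contra! hne
  obtain ⟨h12, h13, h23⟩ := hne
  apply hns
  have hprime : Prime (p : ℤ) := Nat.prime_iff_prime_int.mp hp.out
  obtain ⟨P₁, hP₁, hP₁0⟩ := exists_ne_zero_of_card h₁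
  obtain ⟨P₂, hP₂, hP₂0⟩ := exists_ne_zero_of_card h₂
  obtain ⟨P₃, hP₃, hP₃0⟩ := exists_ne_zero_of_card h₃
  obtain ⟨l₁, hl₁⟩ := exists_zsmul_eq_of_mem hpT h₁ h₁T hP₁ hP₁0 (h₁g P₁ hP₁)
  obtain ⟨l₂, hl₂⟩ := exists_zsmul_eq_of_mem hpT h₂ h₂T hP₂ hP₂0 (h₂g P₂ hP₂)
  obtain ⟨l₃, hl₃⟩ := exists_zsmul_eq_of_mem hpT h₃ h₃T hP₃ hP₃0 (h₃g P₃ hP₃)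
  have hsup : Φ₁ ⊔ Φ₂ = T := sup_eq_of_ne hT h₁ h₁T h₂ h₂T h12
  have hP₃sup : P₃ ∈ Φ₁ ⊔ Φ₂ := by rw [hsup]; exact h₃T hP₃
  obtain ⟨y, hy, z, hz, hyz⟩ := AddSubgroup.mem_sup.mp hP₃sup
  obtain ⟨m, rfl⟩ := exists_zsmul_eq_of_mem hpT h₁ h₁T hP₁ hP₁0 hy
  obtain ⟨n, rfl⟩ := exists_zsmul_eq_of_mem hpT h₂ h₂T hP₂ hP₂0 hz
  have key : ((l₁ - l₃) * m) • P₁ + ((l₂ - l₃) * n) • P₂ = 0 := by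
    have e : g • (m • P₁ + n • P₂) = l₃ • (m • P₁ + n • P₂) := by rw [hyz]; exact hl₃.symm
    rw [smul_add, smul_comm g m P₁, smul_comm g n P₂, ← hl₁, ← hl₂] at e
    have : ((l₁ - l₃) * m) • P₁ + ((l₂ - l₃) * n) • P₂ =
        (m • l₁ • P₁ + n • l₂ • P₂) - l₃ • (m • P₁ + n • P₂) := by
      module
    rw [this, e, sub_self]
  have hw₁ : ((l₁ - l₃) * m) • P₁ ∈ Φ₁ := Φ₁.zsmul_mem hP₁ _
  have hw₂ : ((l₁ - l₃) * m) • P₁ ∈ Φ₂ := by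
    rw [eq_neg_of_add_eq_zero_left key]
    exact Φ₂.neg_mem (Φ₂.zsmul_mem hP₂ _)
  have hw0 : ((l₁ - l₃) * m) • P₁ = 0 := by
    by_contra hw0
    exact h12 (eq_of_mem_of_mem hpT h₁ h₁T h₂ h₂T hw₁ hw₂ hw0)
  have hw0' : ((l₂ - l₃) * n) • P₂ = 0 := by rwa [hw0, zero_add] at key
  have hpm : ¬ (p : ℤ) ∣ m := by
    intro hpm
    have hy0 : m • P₁ = 0 := zsmul_eq_zero_of_dvd hpT (h₁T hP₁) hpm
    rw [hy0, zero_add] at hyz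
    have hP₃' : P₃ ∈ Φ₂ := by rw [← hyz]; exact Φ₂.zsmul_mem hP₂ n
    exact h23 (eq_of_mem_of_mem hpT h₂ h₂T h₃ h₃T hP₃' hP₃ hP₃0)
  have hpn : ¬ (p : ℤ) ∣ n := by
    intro hpn
    have hz0 : n • P₂ = 0 := zsmul_eq_zero_of_dvd hpT (h₂T hP₂) hpn
    rw [hz0, add_zero] at hyz
    have hP₃' : P₃ ∈ Φ₁ := by rw [← hyz]; exact Φ₁.zsmul_mem hP₁ m
    exact h13 (eq_of_mem_of_mem hpT h₁ h₁T h₃ h₃T hP₃' hP₃ hP₃0)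
  have hd₁ : (p : ℤ) ∣ l₁ - l₃ :=
    (hprime.dvd_or_dvd ((zsmul_eq_zero_iff_dvd hpT (h₁T hP₁) hP₁0 _).mp hw0)).resolve_right hpm
  have hd₂ : (p : ℤ) ∣ l₂ - l₃ :=
    (hprime.dvd_or_dvd ((zsmul_eq_zero_iff_dvd hpT (h₂T hP₂) hP₂0 _).mp hw0')).resolve_right hpn
  have hd : (p : ℤ) ∣ l₂ - l₁ := by
    have := dvd_sub hd₂ hd₁
    rwa [show l₂ - l₃ - (l₁ - l₃) = l₂ - l₁ by ring] at this
  refine ⟨l₁, fun P hP ↦ ?_⟩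
  have hPsup : P ∈ Φ₁ ⊔ Φ₂ := by rw [hsup]; exact hP
  obtain ⟨y', hy', z', hz', rfl⟩ := AddSubgroup.mem_sup.mp hPsup
  obtain ⟨m', rfl⟩ := exists_zsmul_eq_of_mem hpT h₁ h₁T hP₁ hP₁0 hy'
  obtain ⟨n', rfl⟩ := exists_zsmul_eq_of_mem hpT h₂ h₂T hP₂ hP₂0 hz'
  rw [smul_add, smul_comm g m' P₁, smul_comm g n' P₂, ← hl₁, ← hl₂]
  have hz0 : ((l₂ - l₁) * n') • P₂ = 0 :=
    zsmul_eq_zero_of_dvd hpT (h₂T hP₂) (dvd_mul_of_dvd_left hd _)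
  have : m' • l₁ • P₁ + n' • l₂ • P₂ = l₁ • (m' • P₁ + n' • P₂) + ((l₂ - l₁) * n') • P₂ := by
    module
  rw [this, hz0, add_zero]

/-! ### Case (a): a non-scalar element of the normal subgroup -/

/-- **Case (a) of the descent.**  Let `H ⊴ G`, `T` a `G`-stable `p`-torsion plane, `L` a `G`-stable
line of `T` and `Φ ≠ L` an `H`-stable line.  If some `h ∈ H` is not an integer scalar on `T`, then
`Φ` is `G`-stable: for `g ∈ G` the line `g • Φ` is again `H`-stable (normality), the three
`h`-stable lines `L, Φ, g • Φ` are not pairwise distinct, and `g • Φ = L` would give `Φ = L`; so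
`g • Φ = Φ`. [folklore] -/
theorem smul_mem_of_normal {H : Subgroup G} (hN : H.Normal) {T : AddSubgroup A}
    (hTG : ∀ g : G, ∀ P ∈ T, g • P ∈ T) (hT : Nat.card T = p ^ 2)
    (hpT : ∀ P ∈ T, (p : ℤ) • P = 0) {h : G} (hhH : h ∈ H)
    (hns : ¬ ∃ s : ℤ, ∀ P ∈ T, h • P = s • P)
    {L : AddSubgroup A} (hL : Nat.card L = p) (hLT : L ≤ T) (hLG : ∀ g : G, ∀ P ∈ L, g • P ∈ L)
    {Φ : AddSubgroup A} (hΦ : Nat.card Φ = p) (hΦT : Φ ≤ T)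
    (hΦH : ∀ g ∈ H, ∀ P ∈ Φ, g • P ∈ Φ) (hne : Φ ≠ L) :
    ∀ g : G, ∀ P ∈ Φ, g • P ∈ Φ := by
  intro g
  have hcard : Nat.card ↥(g • Φ) = p := by
    rw [← hΦ]
    change Nat.card ↥((g • Φ : AddSubgroup A) : Set A) = Nat.card ↥(Φ : Set A)
    rw [AddSubgroup.coe_pointwise_smul]
    exact Set.natCard_smul_set g (Φ : Set A)
  have hgΦT : g • Φ ≤ T := fun x hx ↦ by
    obtain ⟨s, hs, rfl⟩ := (AddSubgroup.mem_smul_pointwise_iff_exists x g Φ).mp hx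
    exact hTG g s (hΦT hs)
  have hgΦH : ∀ k ∈ H, ∀ P ∈ g • Φ, k • P ∈ g • Φ := fun k hk x hx ↦ by
    obtain ⟨s, hs, rfl⟩ := (AddSubgroup.mem_smul_pointwise_iff_exists x g Φ).mp hx
    rw [smul_smul, show k * g = g * (g⁻¹ * k * g) by group, mul_smul]
    exact AddSubgroup.smul_mem_pointwise_smul _ g Φ (hΦH _ (hN.conj_mem' k hk g) s hs)
  rcases eq_or_eq_or_eq_of_forall_smul_mem hT hpT h hns hL hLT (hLG h) hΦ hΦT (hΦH h hhH)
      hcard hgΦT (hgΦH h hhH) with e | e | e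
  · exact absurd e.symm hne
  · -- `L = g • Φ`: then `Φ ≤ L`, so `Φ = L`
    exfalso
    apply hne
    haveI : Finite L := Nat.finite_of_card_ne_zero (by rw [hL]; exact hp.out.ne_zero)
    refine AddSubgroup.eq_of_le_of_card_ge (fun s hs ↦ ?_) (by rw [hL, hΦ])
    have hgs : g • s ∈ L := by rw [e]; exact AddSubgroup.smul_mem_pointwise_smul s g Φ hs
    have := hLG g⁻¹ _ hgs
    rwa [inv_smul_smul] at this
  · -- `Φ = g • Φ`
    intro P hP
    have := AddSubgroup.smul_mem_pointwise_smul P g Φ hP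
    rwa [← e] at this

/-! ### Case (b): the subgroup acts by scalars -/

/-- **Case (b) of the descent (needs `p` odd and index two).**  If every `h ∈ H` is an integer
scalar on the `G`-stable `p`-torsion plane `T`, `[G : H] = 2` and `p ≠ 2`, then `T` does NOT have
exactly one `G`-stable line.  Proof: pick `g ∉ H`, the `G`-line `L = ⟨P₀⟩` with `g • P₀ = a • P₀`,
`g * g ∈ H` acting as `c ≡ a² (mod p)`, and `Q ∈ T \ L`; then `R := g • Q - a • Q` has
`g • R = -a • R`.  A cyclic subgroup `⟨X⟩ ≤ T` with `g • X ∈ ℤX` is `G`-stable (`G = H ∪ gH`, `H`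
scalar), hence equals `L` if `X ≠ 0`.  If `R = 0` this makes `⟨Q⟩ = L`, i.e. `Q ∈ L`; otherwise
`⟨R⟩ = L`, so `g • R = a • R` too, `2a • R = 0`, `p ∣ 2a`, `p ∣ a`, `g • P₀ = 0`, `P₀ = 0`.
[folklore] -/
theorem false_of_forall_exists_smul_eq (hp2 : p ≠ 2) {H : Subgroup G} (hH : H.index = 2)
    {T : AddSubgroup A} (hTG : ∀ g : G, ∀ P ∈ T, g • P ∈ T) (hT : Nat.card T = p ^ 2)
    (hpT : ∀ P ∈ T, (p : ℤ) • P = 0) (hsc : ∀ h ∈ H, ∃ s : ℤ, ∀ P ∈ T, h • P = s • P)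
    {L : AddSubgroup A} (hL : Nat.card L = p) (hLT : L ≤ T) (hLG : ∀ g : G, ∀ P ∈ L, g • P ∈ L)
    (huniq : ∀ Φ : AddSubgroup A, Nat.card Φ = p → Φ ≤ T →
      (∀ g : G, ∀ P ∈ Φ, g • P ∈ Φ) → Φ = L) : False := by
  have hprime : Prime (p : ℤ) := Nat.prime_iff_prime_int.mp hp.out
  obtain ⟨g, hgH, -⟩ := Subgroup.index_eq_two_iff_exists_notMem_and.mp hH
  have hGst : ∀ {Q : A}, Q ∈ T → ∀ b : ℤ, g • Q = b • Q →
      ∀ σ : G, ∀ P ∈ AddSubgroup.zmultiples Q, σ • P ∈ AddSubgroup.zmultiples Q := by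
    intro Q hQT b hb σ P hP
    obtain ⟨k, rfl⟩ := AddSubgroup.mem_zmultiples_iff.mp hP
    rw [smul_comm]
    refine AddSubgroup.zsmul_mem _ ?_ k
    by_cases hσ : σ ∈ H
    · obtain ⟨s, hs⟩ := hsc σ hσ
      rw [hs Q hQT]
      exact AddSubgroup.zsmul_mem _ (AddSubgroup.mem_zmultiples Q) s
    · have hτ : g⁻¹ * σ ∈ H := by
        rw [Subgroup.mul_mem_iff_of_index_two hH, inv_mem_iff]
        exact iff_of_false hgH hσ
      obtain ⟨s, hs⟩ := hsc _ hτ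
      rw [show σ = g * (g⁻¹ * σ) by group, mul_smul, hs Q hQT, smul_comm, hb]
      exact AddSubgroup.zsmul_mem _ (AddSubgroup.zsmul_mem _ (AddSubgroup.mem_zmultiples Q) b) s
  have hmemL : ∀ {Q : A}, Q ∈ T → Q ≠ 0 → ∀ b : ℤ, g • Q = b • Q → Q ∈ L := by
    intro Q hQT hQ0 b hb
    rw [← huniq (AddSubgroup.zmultiples Q) (card_zmultiples_eq hpT hQT hQ0)
      (AddSubgroup.zmultiples_le.mpr hQT) (hGst hQT b hb)]
    exact AddSubgroup.mem_zmultiples Q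
  obtain ⟨P₀, hP₀, hP₀0⟩ := exists_ne_zero_of_card hL
  obtain ⟨a, ha⟩ := exists_zsmul_eq_of_mem hpT hL hLT hP₀ hP₀0 (hLG g P₀ hP₀)
  obtain ⟨c, hc⟩ := hsc (g * g) (Subgroup.mul_self_mem_of_index_two hH g)
  have hca : (p : ℤ) ∣ c - a * a := by
    have e : c • P₀ = (a * a) • P₀ := by
      rw [← hc P₀ (hLT hP₀), mul_smul, ← ha, smul_comm g a P₀, ← ha, smul_smul]
    exact (zsmul_eq_zero_iff_dvd hpT (hLT hP₀) hP₀0 _).mp (by rw [sub_smul, e, sub_self])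
  obtain ⟨Q, hQT, hQL⟩ := exists_mem_not_mem hT hL
  have hQ0 : Q ≠ 0 := fun h0 ↦ hQL (by rw [h0]; exact L.zero_mem)
  have hRT : g • Q - a • Q ∈ T := T.sub_mem (hTG g Q hQT) (T.zsmul_mem hQT a)
  have hgR : g • (g • Q - a • Q) = (-a) • (g • Q - a • Q) := by
    have h0 : (c - a * a) • Q = 0 := zsmul_eq_zero_of_dvd hpT hQT hca
    rw [smul_sub, smul_smul, hc Q hQT, smul_comm g a Q]
    have : ∀ X : A, c • Q - a • X - (-a) • (X - a • Q) = (c - a * a) • Q := fun X ↦ by module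
    exact sub_eq_zero.mp ((this (g • Q)).trans h0)
  by_cases hR0 : g • Q - a • Q = 0
  · -- `g • Q = a • Q`: `⟨Q⟩` is a second `G`-stable line
    exact hQL (hmemL hQT hQ0 a (sub_eq_zero.mp hR0))
  · -- `⟨R⟩ = L`: then `g • R = a • R = -a • R`, `2a • R = 0`, `p ∣ a`
    have hRL : g • Q - a • Q ∈ L := hmemL hRT hR0 (-a) hgR
    obtain ⟨k, hk⟩ := exists_zsmul_eq_of_mem hpT hL hLT hP₀ hP₀0 hRL
    have hgR' : g • (g • Q - a • Q) = a • (g • Q - a • Q) := by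
      rw [← hk, smul_comm g k P₀, ← ha, smul_comm a k P₀]
    have h2a : (2 * a) • (g • Q - a • Q) = 0 := by
      have : ∀ X : A, (2 * a) • X = a • X - (-a) • X := fun X ↦ by module
      rw [this, ← hgR, ← hgR', sub_self]
    rcases hprime.dvd_or_dvd ((zsmul_eq_zero_iff_dvd hpT hRT hR0 _).mp h2a) with h2 | hpa
    · exact hp2 ((Nat.prime_dvd_prime_iff_eq hp.out Nat.prime_two).mp (by exact_mod_cast h2))
    · apply hP₀0
      have : g • P₀ = 0 := by rw [← ha]; exact zsmul_eq_zero_of_dvd hpT (hLT hP₀) hpa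
      exact (smul_eq_zero_iff_eq g).mp this

/-! ### The descent -/

/-- **Index-two descent of a unique stable line (odd `p`).**  `G` acts additively on `A`,
`H ≤ G` has index two, `p ≠ 2` is prime, `T ≤ A` is `G`-stable with `Nat.card T = p ^ 2` and
`p • T = 0`.  If `L` is a `G`-stable subgroup of order `p` of `T` and the ONLY one, then every
`H`-stable subgroup of order `p` of `T` equals `L`.  (Case split on whether `H` acts on `T` by
integer scalars: `smul_mem_of_normal` / `false_of_forall_exists_smul_eq`.)  False for `p = 2` and
for index `p`. [folklore] -/
theorem eq_of_index_two (hp2 : p ≠ 2) {H : Subgroup G} (hH : H.index = 2)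
    {T : AddSubgroup A} (hTG : ∀ g : G, ∀ P ∈ T, g • P ∈ T) (hT : Nat.card T = p ^ 2)
    (hpT : ∀ P ∈ T, (p : ℤ) • P = 0)
    {L : AddSubgroup A} (hL : Nat.card L = p) (hLT : L ≤ T) (hLG : ∀ g : G, ∀ P ∈ L, g • P ∈ L)
    (huniq : ∀ Φ : AddSubgroup A, Nat.card Φ = p → Φ ≤ T →
      (∀ g : G, ∀ P ∈ Φ, g • P ∈ Φ) → Φ = L)
    {Φ : AddSubgroup A} (hΦ : Nat.card Φ = p) (hΦT : Φ ≤ T)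
    (hΦH : ∀ g ∈ H, ∀ P ∈ Φ, g • P ∈ Φ) : Φ = L := by
  by_contra hne
  by_cases hsc : ∀ h ∈ H, ∃ s : ℤ, ∀ P ∈ T, h • P = s • P
  · exact false_of_forall_exists_smul_eq hp2 hH hTG hT hpT hsc hL hLT hLG huniq
  · push Not at hsc
    obtain ⟨h, hhH, hns'⟩ := hsc
    have hns : ¬ ∃ s : ℤ, ∀ P ∈ T, h • P = s • P := by
      rintro ⟨s, hs⟩
      obtain ⟨P, hPT, hP⟩ := hns' s
      exact hP (hs P hPT)
    exact hne (huniq Φ hΦ hΦT (smul_mem_of_normal (Subgroup.normal_of_index_eq_two hH) hTG hT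
      hpT hhH hns hL hLT hLG hΦ hΦT hΦH hne))

/-- **Index-two descent of stable-line uniqueness, `huniq` shape (odd `p`).**  With `G, H, p, T`
as in `eq_of_index_two`: if `T` contains SOME `G`-stable subgroup of order `p` and any two
`G`-stable subgroups of order `p` of `T` coincide, then any two `H`-stable subgroups of order `p`
of `T` coincide.  (The existence hypothesis is necessary: an irreducible `G`-plane induced from a
character of `H` has no `G`-line and two `H`-lines.) [folklore] -/
theorem unique_of_index_two (hp2 : p ≠ 2) {H : Subgroup G} (hH : H.index = 2)
    {T : AddSubgroup A} (hTG : ∀ g : G, ∀ P ∈ T, g • P ∈ T) (hT : Nat.card T = p ^ 2)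
    (hpT : ∀ P ∈ T, (p : ℤ) • P = 0)
    (hex : ∃ L : AddSubgroup A, Nat.card L = p ∧ L ≤ T ∧ ∀ g : G, ∀ P ∈ L, g • P ∈ L)
    (huniq : ∀ Φ Φ' : AddSubgroup A, Nat.card Φ = p → Φ ≤ T →
      (∀ g : G, ∀ P ∈ Φ, g • P ∈ Φ) → Nat.card Φ' = p → Φ' ≤ T →
      (∀ g : G, ∀ P ∈ Φ', g • P ∈ Φ') → Φ = Φ')
    (Φ Φ' : AddSubgroup A) (hΦ : Nat.card Φ = p) (hΦT : Φ ≤ T)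
    (hΦH : ∀ g ∈ H, ∀ P ∈ Φ, g • P ∈ Φ) (hΦ' : Nat.card Φ' = p) (hΦ'T : Φ' ≤ T)
    (hΦ'H : ∀ g ∈ H, ∀ P ∈ Φ', g • P ∈ Φ') : Φ = Φ' := by
  obtain ⟨L, hL, hLT, hLG⟩ := hex
  have huniqL : ∀ Ψ : AddSubgroup A, Nat.card Ψ = p → Ψ ≤ T →
      (∀ g : G, ∀ P ∈ Ψ, g • P ∈ Ψ) → Ψ = L :=
    fun Ψ h1 h2 h3 ↦ huniq Ψ L h1 h2 h3 hL hLT hLG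
  rw [eq_of_index_two hp2 hH hTG hT hpT hL hLT hLG huniqL hΦ hΦT hΦH,
    eq_of_index_two hp2 hH hTG hT hpT hL hLT hLG huniqL hΦ' hΦ'T hΦ'H]

/-- **Index-two descent of stable-line uniqueness along a homomorphism (odd `p`).**  Same as
`unique_of_index_two` for a group `Γ` acting on `A` THROUGH a homomorphism `f : Γ →* G` whose
range has index two in `G` (e.g. the restriction map `Γ_K → Γ_ℚ` of absolute Galois groups for a
quadratic field `K`, an injection that is not an inclusion of subgroups): `Γ`-stability of `Φ`
means `∀ τ, ∀ P ∈ Φ, f τ • P ∈ Φ`. [folklore] -/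
theorem unique_of_range_index_two {Γ : Type*} [Group Γ] (f : Γ →* G) (hp2 : p ≠ 2)
    (hf : f.range.index = 2)
    {T : AddSubgroup A} (hTG : ∀ g : G, ∀ P ∈ T, g • P ∈ T) (hT : Nat.card T = p ^ 2)
    (hpT : ∀ P ∈ T, (p : ℤ) • P = 0)
    (hex : ∃ L : AddSubgroup A, Nat.card L = p ∧ L ≤ T ∧ ∀ g : G, ∀ P ∈ L, g • P ∈ L)
    (huniq : ∀ Φ Φ' : AddSubgroup A, Nat.card Φ = p → Φ ≤ T →
      (∀ g : G, ∀ P ∈ Φ, g • P ∈ Φ) → Nat.card Φ' = p → Φ' ≤ T →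
      (∀ g : G, ∀ P ∈ Φ', g • P ∈ Φ') → Φ = Φ')
    (Φ Φ' : AddSubgroup A) (hΦ : Nat.card Φ = p) (hΦT : Φ ≤ T)
    (hΦΓ : ∀ τ : Γ, ∀ P ∈ Φ, f τ • P ∈ Φ) (hΦ' : Nat.card Φ' = p) (hΦ'T : Φ' ≤ T)
    (hΦ'Γ : ∀ τ : Γ, ∀ P ∈ Φ', f τ • P ∈ Φ') : Φ = Φ' :=
  unique_of_index_two hp2 hf hTG hT hpT hex huniq Φ Φ' hΦ hΦT
    (fun g hg P hP ↦ by obtain ⟨τ, rfl⟩ := MonoidHom.mem_range.mp hg; exact hΦΓ τ P hP)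
    hΦ' hΦ'T
    (fun g hg P hP ↦ by obtain ⟨τ, rfl⟩ := MonoidHom.mem_range.mp hg; exact hΦ'Γ τ P hP)

end Summit.BirchSwinnertonDyer.BirchSwinnertonDyer.Theorems.StableLine
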